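import Mathlib
import HarnessLib

/-!
# `NoHeavyLowerTail` (crux stmt-CriticalPhenomena-4575), law-level frontier: the Gladkov–Zimin two-copy inequality
# for LOG-SUPERMODULAR weights (Lemma A of the conditional Gladkov–Zimin theorem)

Support file (prover seat `prim-bnk-1` gen 14; `--supports stmt-CriticalPhenomena-4575`; no computation, no new definition).

Gladkov–Zimin (draft 2024, Thm. 2.1; tree `Literature.Probability.Percolation.DecisionTree.ED_ED_le_ED_diag`) prove, for a
PRODUCT weight `μ` on the cube `2^D` and a kernel `g` with `g x t + g y z ≤ g x z + g y t` whenever `x ⊆ y`, `z ⊆ t`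
("cross-supermodular": mixed ≤ pure), that the two-copy average of `g` is at most its diagonal average.  Here we prove the
same conclusion for every LOG-SUPERMODULAR weight `μ ≥ 0` (`μ s · μ t ≤ μ (s ∩ t) · μ (s ∪ t)`), in the denominator-free form

  `Σ_{s,t ⊆ D} μ s · μ t · g s t ≤ (Σ_{t ⊆ D} μ t) · Σ_{s ⊆ D} μ s · g s s`      (`lsm_twoCopy_le`).

For `g s t = -f s · h t` with `f, h` increasing this is the FKG inequality; for product weights it is GZ Thm. 2.1.  It is the
"anti-alignment lemma" needed by the conditional Gladkov–Zimin theorem of this seat (memo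
run/shared/lean/prim/prim-l12/FROM-prim-bnk-1-gen14-CONDITIONAL-GZ-PROVED.md, §1), where it is applied to the tilted law of
the first layer around the spectator set, which is log-supermodular by van den Berg–Häggström–Kahn's Theorem 1.1 but not a
product weight.

Proof (induction on `D`, as in GZ, with Holley replacing independence).  For `D = D' + e` split `μ` into
`μ₀ = μ`, `μ₁ = μ (insert e ·)` on `2^{D'}`; these are Holley-ordered (`μ₀ s · μ₁ t ≤ μ₀ (s ∩ t) · μ₁ (s ∪ t)`), so
`M₁ · Σ μ₀ F ≤ M₀ · Σ μ₁ F` for increasing `F` (`holley_powerset`, from Mathlib's `Finset.four_functions_theorem`).  The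
induction hypothesis handles the two pure blocks; the mixed blocks are bounded by the KEY inequality
`M₀ M₁ (Q₀₁ + Q₁₀) ≤ M₁² Q₀₀ + M₀² Q₁₁`, obtained from three applications of Holley to increasing differences of `g`
(`key_ineq`).
-/

namespace Summit.CriticalPhenomena.PercolationContinuityZ3.Theorems.LsmTwoCopy

open Finset

variable {ι : Type*} [DecidableEq ι]

/-- **Holley's inequality, un-normalised, on a powerset.**  If `μ₀, μ₁ ≥ 0` satisfy Holley's condition
`μ₀ s · μ₁ t ≤ μ₀ (s ∩ t) · μ₁ (s ∪ t)` on `2^u` and `F` is increasing on `2^u`, then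
`(Σ μ₀ F) · (Σ μ₁) ≤ (Σ μ₀) · (Σ μ₁ F)` (sums over `u.powerset`).  From the four functions theorem. [this work] -/
theorem holley_powerset (u : Finset ι) (μ₀ μ₁ F : Finset ι → ℝ)
    (h0 : ∀ s, 0 ≤ μ₀ s) (h1 : ∀ s, 0 ≤ μ₁ s)
    (hμ : ∀ ⦃s⦄, s ⊆ u → ∀ ⦃t⦄, t ⊆ u → μ₀ s * μ₁ t ≤ μ₀ (s ∩ t) * μ₁ (s ∪ t))
    (hF : ∀ ⦃s t⦄, s ⊆ t → t ⊆ u → F s ≤ F t) :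
    (∑ s ∈ u.powerset, μ₀ s * F s) * (∑ s ∈ u.powerset, μ₁ s) ≤
      (∑ s ∈ u.powerset, μ₀ s) * (∑ s ∈ u.powerset, μ₁ s * F s) := by
  -- shift `F` to be nonnegative on `2^u`
  set F' : Finset ι → ℝ := fun s => max (F s - F ∅) 0 with hF'
  have hF'eq : ∀ s, s ⊆ u → F' s = F s - F ∅ := fun s hs =>
    max_eq_left (sub_nonneg.2 (hF (empty_subset s) hs))
  have hF'0 : ∀ s, 0 ≤ F' s := fun s => le_max_right _ _
  have hF'mono : ∀ ⦃s t⦄, s ⊆ t → t ⊆ u → F' s ≤ F' t := fun s t hst htu => by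
    rw [hF'eq s (hst.trans htu), hF'eq t htu]
    exact sub_le_sub_right (hF hst htu) _
  have h4 := Finset.four_functions_theorem u (f₁ := fun s => μ₀ s * F' s) (f₂ := μ₁) (f₃ := μ₀)
    (f₄ := fun s => μ₁ s * F' s)
    (fun s => mul_nonneg (h0 s) (hF'0 s)) (fun s => h1 s) (fun s => h0 s)
    (fun s => mul_nonneg (h1 s) (hF'0 s)) ?_ (subset_refl u.powerset) (subset_refl u.powerset)
  · rw [powerset_infs_powerset_self, powerset_sups_powerset_self] at h4
    -- undo the shift
    have e1 : ∑ s ∈ u.powerset, μ₀ s * F' s = ∑ s ∈ u.powerset, μ₀ s * F s - F ∅ * ∑ s ∈ u.powerset, μ₀ s := by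
      rw [Finset.mul_sum, ← Finset.sum_sub_distrib]
      exact Finset.sum_congr rfl fun s hs => by rw [hF'eq s (mem_powerset.1 hs)]; ring
    have e2 : ∑ s ∈ u.powerset, μ₁ s * F' s = ∑ s ∈ u.powerset, μ₁ s * F s - F ∅ * ∑ s ∈ u.powerset, μ₁ s := by
      rw [Finset.mul_sum, ← Finset.sum_sub_distrib]
      exact Finset.sum_congr rfl fun s hs => by rw [hF'eq s (mem_powerset.1 hs)]; ring
    have h4' : (∑ s ∈ u.powerset, μ₀ s * F' s) * (∑ s ∈ u.powerset, μ₁ s) ≤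
        (∑ s ∈ u.powerset, μ₀ s) * (∑ s ∈ u.powerset, μ₁ s * F' s) := h4
    rw [e1, e2] at h4'
    nlinarith [h4']
  · intro s hs t ht
    show μ₀ s * F' s * μ₁ t ≤ μ₀ (s ∩ t) * (μ₁ (s ∪ t) * F' (s ∪ t))
    have hst : F' s ≤ F' (s ∪ t) := hF'mono subset_union_left (union_subset hs ht)
    calc μ₀ s * F' s * μ₁ t = (μ₀ s * μ₁ t) * F' s := by ring
      _ ≤ (μ₀ (s ∩ t) * μ₁ (s ∪ t)) * F' (s ∪ t) :=
          mul_le_mul (hμ hs ht) hst (hF'0 s) (mul_nonneg (h0 _) (h1 _))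
      _ = μ₀ (s ∩ t) * (μ₁ (s ∪ t) * F' (s ∪ t)) := by ring

/-- One Holley step of the induction: for `G` increasing on `2^{insert e u}` and Holley-ordered `μ₀, μ₁ ≥ 0` on `2^u`,
`M₁ · Σ_c μ₀ c · G c ≤ M₀ · Σ_c μ₁ c · G (insert e c)` (sums over `u.powerset`, `Mᵢ = Σ μᵢ`). [this work] -/
theorem holley_step (u : Finset ι) (e : ι) (μ₀ μ₁ G : Finset ι → ℝ)
    (h0 : ∀ s, 0 ≤ μ₀ s) (h1 : ∀ s, 0 ≤ μ₁ s)
    (hμ : ∀ ⦃s⦄, s ⊆ u → ∀ ⦃t⦄, t ⊆ u → μ₀ s * μ₁ t ≤ μ₀ (s ∩ t) * μ₁ (s ∪ t))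
    (hG : ∀ ⦃s t⦄, s ⊆ t → t ⊆ insert e u → G s ≤ G t) :
    (∑ s ∈ u.powerset, μ₁ s) * (∑ c ∈ u.powerset, μ₀ c * G c) ≤
      (∑ s ∈ u.powerset, μ₀ s) * (∑ c ∈ u.powerset, μ₁ c * G (insert e c)) := by
  have hH := holley_powerset u μ₀ μ₁ G h0 h1 hμ
    (fun s t hst htu => hG hst (htu.trans (subset_insert e u)))
  have hmono : ∑ c ∈ u.powerset, μ₁ c * G c ≤ ∑ c ∈ u.powerset, μ₁ c * G (insert e c) :=
    Finset.sum_le_sum fun c hc => mul_le_mul_of_nonneg_left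
      (hG (subset_insert e c) (insert_subset_insert e (mem_powerset.1 hc))) (h1 c)
  have hM0 : 0 ≤ ∑ s ∈ u.powerset, μ₀ s := Finset.sum_nonneg fun s _ => h0 s
  calc (∑ s ∈ u.powerset, μ₁ s) * (∑ c ∈ u.powerset, μ₀ c * G c)
      = (∑ c ∈ u.powerset, μ₀ c * G c) * (∑ s ∈ u.powerset, μ₁ s) := mul_comm _ _
    _ ≤ (∑ s ∈ u.powerset, μ₀ s) * (∑ c ∈ u.powerset, μ₁ c * G c) := hH
    _ ≤ (∑ s ∈ u.powerset, μ₀ s) * (∑ c ∈ u.powerset, μ₁ c * G (insert e c)) :=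
        mul_le_mul_of_nonneg_left hmono hM0

/-- The KEY inequality of the induction step (memo §1): with `μ₀ = μ`, `μ₁ = μ (insert e ·)` on `2^u` Holley-ordered and `g`
cross-supermodular on `2^{insert e u}`,
`M₀ M₁ (Q₀₁ + Q₁₀) ≤ M₁² Q₀₀ + M₀² Q₁₁`, where `Q_ij = Σ_{s,t} μᵢ s μⱼ t · g (s + i e) (t + j e)`. [this work] -/
theorem key_ineq (u : Finset ι) (e : ι) (μ₀ μ₁ : Finset ι → ℝ) (g : Finset ι → Finset ι → ℝ)
    (h0 : ∀ s, 0 ≤ μ₀ s) (h1 : ∀ s, 0 ≤ μ₁ s)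
    (hμ : ∀ ⦃s⦄, s ⊆ u → ∀ ⦃t⦄, t ⊆ u → μ₀ s * μ₁ t ≤ μ₀ (s ∩ t) * μ₁ (s ∪ t))
    (hg : ∀ ⦃x y z t⦄, x ⊆ y → y ⊆ insert e u → z ⊆ t → t ⊆ insert e u →
      g x t + g y z ≤ g x z + g y t) :
    (∑ s ∈ u.powerset, μ₀ s) * (∑ s ∈ u.powerset, μ₁ s) *
        ((∑ s ∈ u.powerset, ∑ t ∈ u.powerset, μ₀ s * μ₁ t * g s (insert e t)) +
          ∑ s ∈ u.powerset, ∑ t ∈ u.powerset, μ₁ s * μ₀ t * g (insert e s) t) ≤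
      (∑ s ∈ u.powerset, μ₁ s) ^ 2 * (∑ s ∈ u.powerset, ∑ t ∈ u.powerset, μ₀ s * μ₀ t * g s t) +
        (∑ s ∈ u.powerset, μ₀ s) ^ 2 *
          (∑ s ∈ u.powerset, ∑ t ∈ u.powerset, μ₁ s * μ₁ t * g (insert e s) (insert e t)) := by
  set P := u.powerset with hP
  set M0 := ∑ s ∈ P, μ₀ s with hM0
  set M1 := ∑ s ∈ P, μ₁ s with hM1
  have hM0n : 0 ≤ M0 := Finset.sum_nonneg fun s _ => h0 s
  have hM1n : 0 ≤ M1 := Finset.sum_nonneg fun s _ => h1 s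
  -- the auxiliary functions `uu ≤ vv`, `vv` increasing
  set uu : Finset ι → ℝ := fun s =>
    M0 * ∑ c ∈ P, μ₁ c * g s (insert e c) - M1 * ∑ c ∈ P, μ₀ c * g s c with huu
  set vv : Finset ι → ℝ := fun s =>
    M0 * ∑ c ∈ P, μ₁ c * g (insert e s) (insert e c) - M1 * ∑ c ∈ P, μ₀ c * g (insert e s) c with hvv
  have k3 : ∀ s ∈ P, uu s ≤ vv s := by
    intro s hs
    have hsu : s ⊆ u := mem_powerset.1 hs
    -- `G c = g (insert e s) c - g s c` is increasing in `c`
    have hstep := holley_step u e μ₀ μ₁ (fun c => g (insert e s) c - g s c) h0 h1 hμ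
      (fun c c' hcc' hc'u => by
        have := hg (subset_insert e s) (insert_subset_insert e hsu) hcc' hc'u
        linarith)
    have : vv s - uu s = M0 * ∑ c ∈ P, μ₁ c * (g (insert e s) (insert e c) - g s (insert e c)) -
        M1 * ∑ c ∈ P, μ₀ c * (g (insert e s) c - g s c) := by
      simp only [hvv, huu, hM0, hM1, hP]
      rw [show ∀ (a b c d : ℝ), a - b - (c - d) = (a - c) - (b - d) from fun a b c d => by ring,
        ← mul_sub, ← mul_sub, ← Finset.sum_sub_distrib, ← Finset.sum_sub_distrib]
      congr 1
      · congr 1; exact Finset.sum_congr rfl fun c _ => by ring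
      · congr 1; exact Finset.sum_congr rfl fun c _ => by ring
    linarith
  have k4 : ∀ ⦃s t⦄, s ⊆ t → t ⊆ u → vv s ≤ vv t := by
    intro s t hst htu
    have hstep := holley_step u e μ₀ μ₁ (fun c => g (insert e t) c - g (insert e s) c) h0 h1 hμ
      (fun c c' hcc' hc'u => by
        have := hg (insert_subset_insert e hst) (insert_subset_insert e htu) hcc' hc'u
        linarith)
    have : vv t - vv s = M0 * ∑ c ∈ P, μ₁ c * (g (insert e t) (insert e c) - g (insert e s) (insert e c)) -
        M1 * ∑ c ∈ P, μ₀ c * (g (insert e t) c - g (insert e s) c) := by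
      simp only [hvv, hM0, hM1, hP]
      rw [show ∀ (a b c d : ℝ), a - b - (c - d) = (a - c) - (b - d) from fun a b c d => by ring,
        ← mul_sub, ← mul_sub, ← Finset.sum_sub_distrib, ← Finset.sum_sub_distrib]
      congr 1
      · congr 1; exact Finset.sum_congr rfl fun c _ => by ring
      · congr 1; exact Finset.sum_congr rfl fun c _ => by ring
    linarith
  -- (k1), (k2): the sums of `uu`, `vv` against `μ₀`, `μ₁`
  have k1 : ∑ s ∈ P, μ₀ s * uu s = M0 * (∑ s ∈ P, ∑ t ∈ P, μ₀ s * μ₁ t * g s (insert e t)) -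
      M1 * (∑ s ∈ P, ∑ t ∈ P, μ₀ s * μ₀ t * g s t) := by
    simp only [huu]
    rw [Finset.mul_sum, Finset.mul_sum, ← Finset.sum_sub_distrib]
    refine Finset.sum_congr rfl fun s _ => ?_
    rw [mul_sub, Finset.mul_sum, Finset.mul_sum, Finset.mul_sum, Finset.mul_sum, Finset.mul_sum,
      Finset.mul_sum, ← Finset.sum_sub_distrib, ← Finset.sum_sub_distrib]
    exact Finset.sum_congr rfl fun t _ => by ring
  have k2 : ∑ s ∈ P, μ₁ s * vv s =
      M0 * (∑ s ∈ P, ∑ t ∈ P, μ₁ s * μ₁ t * g (insert e s) (insert e t)) -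
      M1 * (∑ s ∈ P, ∑ t ∈ P, μ₁ s * μ₀ t * g (insert e s) t) := by
    simp only [hvv]
    rw [Finset.mul_sum, Finset.mul_sum, ← Finset.sum_sub_distrib]
    refine Finset.sum_congr rfl fun s _ => ?_
    rw [mul_sub, Finset.mul_sum, Finset.mul_sum, Finset.mul_sum, Finset.mul_sum, Finset.mul_sum,
      Finset.mul_sum, ← Finset.sum_sub_distrib, ← Finset.sum_sub_distrib]
    exact Finset.sum_congr rfl fun t _ => by ring
  -- (k5): `M1 Σ μ₀ uu ≤ M1 Σ μ₀ vv ≤ M0 Σ μ₁ vv`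
  have k5a : M1 * ∑ s ∈ P, μ₀ s * uu s ≤ M1 * ∑ s ∈ P, μ₀ s * vv s :=
    mul_le_mul_of_nonneg_left (Finset.sum_le_sum fun s hs =>
      mul_le_mul_of_nonneg_left (k3 s hs) (h0 s)) hM1n
  have k5b : M1 * ∑ s ∈ P, μ₀ s * vv s ≤ M0 * ∑ s ∈ P, μ₁ s * vv s := by
    have := holley_powerset u μ₀ μ₁ vv h0 h1 hμ k4
    rw [mul_comm] at this
    exact this
  have k5 := k5a.trans k5b
  rw [k1, k2] at k5
  nlinarith [k5]

/-- **Lemma A (memo §1): the Gladkov–Zimin two-copy inequality for log-supermodular weights.**  For `μ ≥ 0`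
log-supermodular on `2^D` and `g` cross-supermodular on `2^D` (`g x t + g y z ≤ g x z + g y t` for `x ⊆ y`, `z ⊆ t`):
`Σ_{s,t ⊆ D} μ s μ t · g s t ≤ (Σ_{t ⊆ D} μ t) · Σ_{s ⊆ D} μ s · g s s`.  (Product weights: Gladkov–Zimin draft 2024 Thm. 2.1;
`g = -f ⊗ h`: FKG.) [this work] -/
theorem lsm_twoCopy_le (D : Finset ι) (μ : Finset ι → ℝ) (hμ0 : ∀ s, 0 ≤ μ s)
    (hμ : ∀ ⦃s⦄, s ⊆ D → ∀ ⦃t⦄, t ⊆ D → μ s * μ t ≤ μ (s ∩ t) * μ (s ∪ t))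
    (g : Finset ι → Finset ι → ℝ)
    (hg : ∀ ⦃x y z t⦄, x ⊆ y → y ⊆ D → z ⊆ t → t ⊆ D → g x t + g y z ≤ g x z + g y t) :
    ∑ s ∈ D.powerset, ∑ t ∈ D.powerset, μ s * μ t * g s t ≤
      (∑ t ∈ D.powerset, μ t) * ∑ s ∈ D.powerset, μ s * g s s := by
  induction D using Finset.induction_on generalizing μ g with
  | empty =>
    simp only [Finset.powerset_empty, Finset.sum_singleton]
    nlinarith [hμ0 ∅]
  | @insert e u he ih =>
    -- split every sum over `2^{insert e u}` into `s` and `insert e s`, `s ⊆ u`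
    simp only [Finset.sum_powerset_insert he]
    set P := u.powerset with hP
    set μ₁ : Finset ι → ℝ := fun s => μ (insert e s) with hμ₁
    have h1 : ∀ s, 0 ≤ μ₁ s := fun s => hμ0 _
    have huD : u ⊆ insert e u := subset_insert e u
    -- Holley order between `μ` and `μ₁` on `2^u`, and log-supermodularity of `μ₁`
    have hHol : ∀ ⦃s⦄, s ⊆ u → ∀ ⦃t⦄, t ⊆ u → μ s * μ₁ t ≤ μ (s ∩ t) * μ₁ (s ∪ t) := by
      intro s hs t ht
      have hes : e ∉ s := fun h => he (hs h)
      have := hμ (hs.trans huD) (insert_subset_insert e ht)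
      rwa [inter_insert_of_notMem hes, union_insert] at this
    have hμ₁lsm : ∀ ⦃s⦄, s ⊆ u → ∀ ⦃t⦄, t ⊆ u → μ₁ s * μ₁ t ≤ μ₁ (s ∩ t) * μ₁ (s ∪ t) := by
      intro s hs t ht
      have := hμ (insert_subset_insert e hs) (insert_subset_insert e ht)
      rwa [← insert_inter_distrib, ← insert_union_distrib] at this
    have hμlsm : ∀ ⦃s⦄, s ⊆ u → ∀ ⦃t⦄, t ⊆ u → μ s * μ t ≤ μ (s ∩ t) * μ (s ∪ t) :=
      fun s hs t ht => hμ (hs.trans huD) (ht.trans huD)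
    -- induction hypotheses for the two pure blocks
    have IH0 := ih μ hμ0 hμlsm g (fun x y z t hxy hyu hzt htu => hg hxy (hyu.trans huD) hzt (htu.trans huD))
    have IH1 := ih μ₁ h1 hμ₁lsm (fun x z => g (insert e x) (insert e z))
      (fun x y z t hxy hyu hzt htu => hg (insert_subset_insert e hxy) (insert_subset_insert e hyu)
        (insert_subset_insert e hzt) (insert_subset_insert e htu))
    have KEY := key_ineq u e μ μ₁ g hμ0 h1 hHol hg
    set M0 := ∑ s ∈ P, μ s with hM0
    set M1 := ∑ s ∈ P, μ₁ s with hM1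
    set Q00 := ∑ s ∈ P, ∑ t ∈ P, μ s * μ t * g s t with hQ00
    set Q01 := ∑ s ∈ P, ∑ t ∈ P, μ s * μ₁ t * g s (insert e t) with hQ01
    set Q10 := ∑ s ∈ P, ∑ t ∈ P, μ₁ s * μ t * g (insert e s) t with hQ10
    set Q11 := ∑ s ∈ P, ∑ t ∈ P, μ₁ s * μ₁ t * g (insert e s) (insert e t) with hQ11
    set Δ0 := ∑ s ∈ P, μ s * g s s with hΔ0
    set Δ1 := ∑ s ∈ P, μ₁ s * g (insert e s) (insert e s) with hΔ1
    have hM0n : 0 ≤ M0 := Finset.sum_nonneg fun s _ => hμ0 s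
    have hM1n : 0 ≤ M1 := Finset.sum_nonneg fun s _ => h1 s
    -- goal in this notation
    have hsplit : ∑ s ∈ P, (∑ t ∈ P, μ s * μ t * g s t + ∑ t ∈ P, μ s * μ (insert e t) * g s (insert e t)) +
        ∑ s ∈ P, (∑ t ∈ P, μ (insert e s) * μ t * g (insert e s) t +
          ∑ t ∈ P, μ (insert e s) * μ (insert e t) * g (insert e s) (insert e t)) =
        Q00 + Q01 + Q10 + Q11 := by
      rw [Finset.sum_add_distrib, Finset.sum_add_distrib]; ring
    rw [hsplit]
    show Q00 + Q01 + Q10 + Q11 ≤ (M0 + M1) * (Δ0 + Δ1)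
    have hIH0 : Q00 ≤ M0 * Δ0 := IH0
    have hIH1 : Q11 ≤ M1 * Δ1 := IH1
    have hKEY : M0 * M1 * (Q01 + Q10) ≤ M1 ^ 2 * Q00 + M0 ^ 2 * Q11 := KEY
    -- degenerate cases `M0 = 0` / `M1 = 0`
    have hzero0 : M0 = 0 → Q01 = 0 ∧ Q10 = 0 ∧ Q00 = 0 ∧ Δ0 = 0 := by
      intro h0
      have hμz : ∀ s ∈ P, μ s = 0 := fun s hs =>
        (Finset.sum_eq_zero_iff_of_nonneg (fun s _ => hμ0 s)).1 h0 s hs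
      refine ⟨?_, ?_, ?_, ?_⟩
      · exact Finset.sum_eq_zero fun s hs => Finset.sum_eq_zero fun t _ => by rw [hμz s hs]; ring
      · exact Finset.sum_eq_zero fun s _ => Finset.sum_eq_zero fun t ht => by rw [hμz t ht]; ring
      · exact Finset.sum_eq_zero fun s hs => Finset.sum_eq_zero fun t _ => by rw [hμz s hs]; ring
      · exact Finset.sum_eq_zero fun s hs => by rw [hμz s hs]; ring
    have hzero1 : M1 = 0 → Q01 = 0 ∧ Q10 = 0 ∧ Q11 = 0 ∧ Δ1 = 0 := by
      intro h0
      have hμz : ∀ s ∈ P, μ₁ s = 0 := fun s hs =>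
        (Finset.sum_eq_zero_iff_of_nonneg (fun s _ => h1 s)).1 h0 s hs
      refine ⟨?_, ?_, ?_, ?_⟩
      · exact Finset.sum_eq_zero fun s _ => Finset.sum_eq_zero fun t ht => by rw [hμz t ht]; ring
      · exact Finset.sum_eq_zero fun s hs => Finset.sum_eq_zero fun t _ => by rw [hμz s hs]; ring
      · exact Finset.sum_eq_zero fun s hs => Finset.sum_eq_zero fun t _ => by rw [hμz s hs]; ring
      · exact Finset.sum_eq_zero fun s hs => by rw [hμz s hs]; ring
    rcases eq_or_lt_of_le hM0n with hM0z | hM0p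
    · obtain ⟨h01, h10, h00, hΔ⟩ := hzero0 hM0z.symm
      rw [h01, h10, h00, hΔ, ← hM0z]; nlinarith [hIH1]
    rcases eq_or_lt_of_le hM1n with hM1z | hM1p
    · obtain ⟨h01, h10, h11, hΔ⟩ := hzero1 hM1z.symm
      rw [h01, h10, h11, hΔ, ← hM1z]; nlinarith [hIH0]
    -- main case: divide the KEY inequality by `M0 M1 > 0`
    have hmix : Q01 + Q10 ≤ M1 * Δ0 + M0 * Δ1 := by
      have hb : M1 ^ 2 * Q00 + M0 ^ 2 * Q11 ≤ M0 * M1 * (M1 * Δ0 + M0 * Δ1) := by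
        nlinarith [mul_le_mul_of_nonneg_left hIH0 (sq_nonneg M1),
          mul_le_mul_of_nonneg_left hIH1 (sq_nonneg M0)]
      exact le_of_mul_le_mul_left (hKEY.trans hb) (mul_pos hM0p hM1p)
    nlinarith [hmix, hIH0, hIH1]

/-- **Lemma A on the full cube of a finite type, `Set` form** (for the percolation configuration space
`Set (Sym2 V)`): for `μ ≥ 0` log-supermodular on `Set ι` and `g` cross-supermodular,
`Σ_{ω,ω'} μ ω μ ω' g ω ω' ≤ (Σ_ω μ ω) · Σ_ω μ ω g ω ω`. [this work] -/
theorem lsm_twoCopy_le_set [Fintype ι] (μ : Set ι → ℝ) (hμ0 : ∀ s, 0 ≤ μ s)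
    (hμ : ∀ s t, μ s * μ t ≤ μ (s ∩ t) * μ (s ∪ t))
    (g : Set ι → Set ι → ℝ)
    (hg : ∀ ⦃x y z t : Set ι⦄, x ⊆ y → z ⊆ t → g x t + g y z ≤ g x z + g y t) :
    ∑ ω : Set ι, ∑ ω' : Set ι, μ ω * μ ω' * g ω ω' ≤ (∑ ω : Set ι, μ ω) * ∑ ω : Set ι, μ ω * g ω ω := by
  classical
  -- transport along `Finset ι ≃ Set ι`
  set φ : Finset ι ≃ Set ι := Fintype.finsetEquivSet with hφ
  have hφc : ∀ s : Finset ι, φ s = (↑s : Set ι) := fun s => Fintype.finsetEquivSet_apply s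
  have main := lsm_twoCopy_le (Finset.univ : Finset ι) (fun s => μ ↑s) (fun s => hμ0 _)
    (fun s _ t _ => by
      have := hμ ↑s ↑t
      rwa [← Finset.coe_inter, ← Finset.coe_union] at this)
    (fun s t => g ↑s ↑t)
    (fun x y z t hxy _ hzt _ => hg (Finset.coe_subset.2 hxy) (Finset.coe_subset.2 hzt))
  simp only [Finset.powerset_univ] at main
  have e1 : ∑ ω : Set ι, ∑ ω' : Set ι, μ ω * μ ω' * g ω ω' =
      ∑ s : Finset ι, ∑ t : Finset ι, μ ↑s * μ ↑t * g ↑s ↑t := by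
    rw [← Equiv.sum_comp φ]
    refine Fintype.sum_congr _ _ fun s => ?_
    rw [← Equiv.sum_comp φ]
    simp only [hφc]
  have e2 : ∑ ω : Set ι, μ ω = ∑ s : Finset ι, μ ↑s := by
    rw [← Equiv.sum_comp φ]; simp only [hφc]
  have e3 : ∑ ω : Set ι, μ ω * g ω ω = ∑ s : Finset ι, μ ↑s * g ↑s ↑s := by
    rw [← Equiv.sum_comp φ]; simp only [hφc]
  rw [e1, e2, e3]
  exact main

end Summit.CriticalPhenomena.PercolationContinuityZ3.Theorems.LsmTwoCopy
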